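import Summits.Ventures.HodgeRepro.BallCore

/-!
# Invariance bookkeeping for the Hecke-translate wedge (seat p5)

Blind re-derivation cell `pub-hodge-repro`, seat `p5` (second seat on statement (c)).  Built on the
sealer's `BallModel.lean`, on `BallChainRule.lean` (chain rule `Jac_mul`) and on `BallCore.lean`
(`wedge_mulVec`).  Mathlib otherwise.

Statement (c) produces ONE point `z` and ONE `γ ∈ Δ` with `(γ^*F)(z) ∧ G(z) ≠ 0`.  To read this as a
non-zero holomorphic `(2,0)`-form on a finite cover of a ball quotient one needs the bookkeeping of the
translates (the route's Lemma W, ROUTE.md Appendix A4: «the `(i+1)`-form `η ∧ g^*ω` is invariant under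
`Γ″ := Γ′ ∩ g⁻¹Γ′g`»).  With `pull γ F := z ↦ J_γ(z)ᵀ F(γ z)` — the translate of statement (c) —

* `pull_one`, `pull_mul` — `pull` is a right action: `pull (g * h) F = pull h (pull g F)` (chain rule);
* `IsInvariant Γ F` — `pull γ F = F` for every `γ ∈ Γ`;
* `conjSub g Γ` — the conjugate subgroup `g⁻¹ Γ g` (`mem_conjSub`);
* `isInvariant_pull_conj` — a `Γ`-invariant `F` has `g⁻¹ Γ g`-invariant translate `pull g F`;
* `pullTop` — the pull-back of a `(2,0)`-form `ω(z) dz₀ ∧ dz₁`: `(γ^*ω)(z) = det J_γ(z) · ω(γ z)`;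
* `pullTop_wedgeForm` — `γ^*(F ∧ G) = γ^*F ∧ γ^*G`;
* `isInvariantTop_wedgeForm_pull` — **the A4 bookkeeping**: for `Γ`-invariant `F, G` and any
  `g ∈ U(2,1)` the `2`-form `(g^*F) ∧ G` is invariant under `Γ ⊓ g⁻¹ Γ g`;
* `exists_invariantTop_wedgeForm_ne_zero` — the output of statement (c) for `Γ`-invariant fields is a
  NON-ZERO `Γ ⊓ γ⁻¹ Γ γ`-invariant `(2,0)`-form;
* `IsInvariantTop.ne_zero_act` — the non-vanishing set of an invariant top form is stable under the group.

The finite-index statement (`Γ ⊓ g⁻¹ Γ g` has finite index in a congruence `Γ` for `g` rational) is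
NOT formalised here.  Nothing here says anything about the status of the Hodge conjecture for CM abelian
varieties.
-/

set_option autoImplicit false

noncomputable section

namespace Summit.Ventures.HodgeRepro

namespace BallInv

open Matrix hiding J
open BallModel BallCore

/-! ### The translate as a right action -/

/-- The translate (pull-back) of a cotangent field by `γ`, exactly as in statement (c):
`(γ^*F)(z) = J_γ(z)ᵀ F(γ z)`. -/
def pull (γ : U21) (F : Ball → Fin 2 → ℂ) (z : Ball) : Fin 2 → ℂ := (Jac γ z)ᵀ *ᵥ F (act γ z)

/-- `pull γ F z` unfolded. -/
theorem pull_apply (γ : U21) (F : Ball → Fin 2 → ℂ) (z : Ball) :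
    pull γ F z = (Jac γ z)ᵀ *ᵥ F (act γ z) := rfl

/-- The identity translates nothing. -/
theorem pull_one (F : Ball → Fin 2 → ℂ) : pull 1 F = F := by
  funext z
  simp [pull, Jac_one, act_one]

/-- **Chain rule for translates**: `pull (g * h) F = pull h (pull g F)` (a right action). -/
theorem pull_mul (g h : U21) (F : Ball → Fin 2 → ℂ) : pull (g * h) F = pull h (pull g F) := by
  funext z
  simp only [pull, Jac_mul, ← act_mul, Matrix.transpose_mul, Matrix.mulVec_mulVec]

/-- Translating by `g` and then by `g⁻¹` gives the field back. -/
theorem pull_inv_pull (g : U21) (F : Ball → Fin 2 → ℂ) : pull g⁻¹ (pull g F) = F := by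
  rw [← pull_mul, mul_inv_cancel, pull_one]

/-- Translating by `g⁻¹` and then by `g` gives the field back. -/
theorem pull_pull_inv (g : U21) (F : Ball → Fin 2 → ℂ) : pull g (pull g⁻¹ F) = F := by
  rw [← pull_mul, inv_mul_cancel, pull_one]

/-- Translation is additive in the field. -/
theorem pull_add (γ : U21) (F G : Ball → Fin 2 → ℂ) : pull γ (F + G) = pull γ F + pull γ G := by
  funext z
  simp [pull, Matrix.mulVec_add]

/-- Translation is `ℂ`-homogeneous in the field. -/
theorem pull_smul (γ : U21) (c : ℂ) (F : Ball → Fin 2 → ℂ) : pull γ (c • F) = c • pull γ F := by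
  funext z
  simp [pull, Matrix.mulVec_smul]

/-- The translate of the zero field is zero. -/
theorem pull_zero (γ : U21) : pull γ (0 : Ball → Fin 2 → ℂ) = 0 := by
  funext z
  simp [pull]

/-- A translate vanishes identically iff the field does. -/
theorem pull_eq_zero_iff (γ : U21) (F : Ball → Fin 2 → ℂ) : pull γ F = 0 ↔ F = 0 := by
  constructor
  · intro h
    rw [← pull_inv_pull γ F, h, pull_zero]
  · rintro rfl
    exact pull_zero γ

/-- A translate of a non-zero field is non-zero. -/
theorem pull_ne_zero {F : Ball → Fin 2 → ℂ} (hF : F ≠ 0) (γ : U21) : pull γ F ≠ 0 :=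
  fun h => hF ((pull_eq_zero_iff γ F).mp h)

/-! ### Invariant fields and conjugate subgroups -/

/-- A cotangent field invariant under a subgroup `Γ ≤ U(2,1)`: `pull γ F = F` for every `γ ∈ Γ`. -/
def IsInvariant (Γ : Subgroup U21) (F : Ball → Fin 2 → ℂ) : Prop := ∀ γ ∈ Γ, pull γ F = F

/-- Invariance passes to smaller subgroups. -/
theorem IsInvariant.mono {Γ Γ' : Subgroup U21} (h : Γ' ≤ Γ) {F : Ball → Fin 2 → ℂ}
    (hF : IsInvariant Γ F) : IsInvariant Γ' F :=
  fun γ hγ => hF γ (h hγ)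

/-- The conjugate subgroup `g⁻¹ Γ g = {δ : g δ g⁻¹ ∈ Γ}`. -/
def conjSub (g : U21) (Γ : Subgroup U21) : Subgroup U21 := Γ.comap (MulAut.conj g).toMonoidHom

/-- `δ ∈ g⁻¹ Γ g ↔ g δ g⁻¹ ∈ Γ`. -/
theorem mem_conjSub {g : U21} {Γ : Subgroup U21} {δ : U21} :
    δ ∈ conjSub g Γ ↔ g * δ * g⁻¹ ∈ Γ := Iff.rfl

/-- `g⁻¹ Γ g` contains `g⁻¹ γ g` for every `γ ∈ Γ`. -/
theorem inv_mul_mul_mem_conjSub {g : U21} {Γ : Subgroup U21} {γ : U21} (hγ : γ ∈ Γ) :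
    g⁻¹ * γ * g ∈ conjSub g Γ := by
  rw [mem_conjSub]
  have : g * (g⁻¹ * γ * g) * g⁻¹ = γ := by group
  rw [this]
  exact hγ

/-- Conjugating by the identity changes nothing. -/
theorem conjSub_one (Γ : Subgroup U21) : conjSub 1 Γ = Γ := by
  ext δ
  rw [mem_conjSub]
  simp

/-- **A `Γ`-invariant field has `g⁻¹ Γ g`-invariant translate** `pull g F`. -/
theorem isInvariant_pull_conj {Γ : Subgroup U21} {F : Ball → Fin 2 → ℂ} (hF : IsInvariant Γ F)
    (g : U21) : IsInvariant (conjSub g Γ) (pull g F) := by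
  intro δ hδ
  rw [mem_conjSub] at hδ
  calc pull δ (pull g F) = pull (g * δ) F := (pull_mul g δ F).symm
    _ = pull (g * δ * g⁻¹ * g) F := by rw [inv_mul_cancel_right]
    _ = pull g (pull (g * δ * g⁻¹) F) := pull_mul _ _ _
    _ = pull g F := by rw [hF _ hδ]

/-! ### `(2,0)`-forms, their pull-backs and the A4 bookkeeping -/

/-- The `(2,0)`-form `F ∧ G` (its coefficient on `dz₀ ∧ dz₁`). -/
def wedgeForm (F G : Ball → Fin 2 → ℂ) (z : Ball) : ℂ := wedge (F z) (G z)

/-- The pull-back of a `(2,0)`-form `ω(z) dz₀ ∧ dz₁` by `γ`: `(γ^*ω)(z) = det J_γ(z) · ω(γ z)`. -/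
def pullTop (γ : U21) (ω : Ball → ℂ) (z : Ball) : ℂ := (Jac γ z).det * ω (act γ z)

/-- The identity pulls back nothing. -/
theorem pullTop_one (ω : Ball → ℂ) : pullTop 1 ω = ω := by
  funext z
  simp [pullTop, Jac_one, act_one]

/-- Chain rule for pull-backs of `(2,0)`-forms: `pullTop (g * h) ω = pullTop h (pullTop g ω)`. -/
theorem pullTop_mul (g h : U21) (ω : Ball → ℂ) : pullTop (g * h) ω = pullTop h (pullTop g ω) := by
  funext z
  simp only [pullTop, Jac_mul, ← act_mul, Matrix.det_mul]
  ring

/-- `γ^*(F ∧ G) = (γ^*F) ∧ (γ^*G)` — `wedge_mulVec` with `det Mᵀ = det M`. -/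
theorem pullTop_wedgeForm (γ : U21) (F G : Ball → Fin 2 → ℂ) :
    pullTop γ (wedgeForm F G) = wedgeForm (pull γ F) (pull γ G) := by
  funext z
  simp only [pullTop, wedgeForm, pull, wedge_mulVec, Matrix.det_transpose]

/-- A `(2,0)`-form invariant under a subgroup `Γ ≤ U(2,1)`. -/
def IsInvariantTop (Γ : Subgroup U21) (ω : Ball → ℂ) : Prop := ∀ γ ∈ Γ, pullTop γ ω = ω

/-- Invariance of top forms passes to smaller subgroups. -/
theorem IsInvariantTop.mono {Γ Γ' : Subgroup U21} (h : Γ' ≤ Γ) {ω : Ball → ℂ}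
    (hω : IsInvariantTop Γ ω) : IsInvariantTop Γ' ω :=
  fun γ hγ => hω γ (h hγ)

/-- The wedge of two `Γ`-invariant fields is a `Γ`-invariant `(2,0)`-form. -/
theorem isInvariantTop_wedgeForm {Γ : Subgroup U21} {F G : Ball → Fin 2 → ℂ}
    (hF : IsInvariant Γ F) (hG : IsInvariant Γ G) : IsInvariantTop Γ (wedgeForm F G) := by
  intro γ hγ
  rw [pullTop_wedgeForm, hF γ hγ, hG γ hγ]

/-- **The A4 bookkeeping (Lemma W).**  For `Γ`-invariant fields `F, G` and any `g ∈ U(2,1)`, the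
`(2,0)`-form `(g^*F) ∧ G` is invariant under `Γ ⊓ g⁻¹ Γ g`. -/
theorem isInvariantTop_wedgeForm_pull {Γ : Subgroup U21} {F G : Ball → Fin 2 → ℂ}
    (hF : IsInvariant Γ F) (hG : IsInvariant Γ G) (g : U21) :
    IsInvariantTop (Γ ⊓ conjSub g Γ) (wedgeForm (pull g F) G) :=
  isInvariantTop_wedgeForm ((isInvariant_pull_conj hF g).mono inf_le_right) (hG.mono inf_le_left)

/-- The pull-back of a top form vanishes at `z` iff the form vanishes at `γ z` (`det J_γ(z) ≠ 0`). -/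
theorem pullTop_eq_zero_iff (γ : U21) (ω : Ball → ℂ) (z : Ball) :
    pullTop γ ω z = 0 ↔ ω (act γ z) = 0 := by
  simp [pullTop, det_Jac_ne_zero]

/-- The non-vanishing set of a `Γ`-invariant top form is stable under `Γ`. -/
theorem IsInvariantTop.ne_zero_act {Γ : Subgroup U21} {ω : Ball → ℂ} (hω : IsInvariantTop Γ ω)
    {γ : U21} (hγ : γ ∈ Γ) {z : Ball} (hz : ω z ≠ 0) : ω (act γ z) ≠ 0 := by
  intro h
  apply hz
  have h1 : pullTop γ ω z = ω z := congrFun (hω γ hγ) z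
  rw [← h1, pullTop, h, mul_zero]

/-- **From statement (c) to an invariant form.**  If `F, G` are `Γ`-invariant and the output of
statement (c) holds at `(γ, z)` — `(γ^*F)(z) ∧ G(z) ≠ 0` — then `(γ^*F) ∧ G` is a NON-ZERO
`Γ ⊓ γ⁻¹ Γ γ`-invariant `(2,0)`-form on the ball. -/
theorem exists_invariantTop_wedgeForm_ne_zero {Γ : Subgroup U21} {F G : Ball → Fin 2 → ℂ}
    (hF : IsInvariant Γ F) (hG : IsInvariant Γ G) {γ : U21} {z : Ball}
    (h : wedge ((Jac γ z)ᵀ *ᵥ F (act γ z)) (G z) ≠ 0) :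
    IsInvariantTop (Γ ⊓ conjSub γ Γ) (wedgeForm (pull γ F) G) ∧ wedgeForm (pull γ F) G ≠ 0 := by
  refine ⟨isInvariantTop_wedgeForm_pull hF hG γ, ?_⟩
  intro h0
  apply h
  have := congrFun h0 z
  simpa [wedgeForm, pull] using this

end BallInv

end Summit.Ventures.HodgeRepro

end
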